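import Summits.AtomisticToContinuum.BoseEinsteinCondensation.Theorems.DensityResponse.Negative.FreeChord
import Literature.MathematicalPhysics.QuantumManyBody.PeriodicBoseGasImpurityTranslation
import Literature.MathematicalPhysics.QuantumManyBody.PeriodicHeatFlowSpectralProofs

/-!
# Negative lemmas for crux `DensityResponse` (stmt-AtomisticToContinuum-9481), VIII: decorations

Supports (does not close) stmt-AtomisticToContinuum-9481 (route `BECThomsonPrinciple`, rank 4); landed
copy of §12 of `Cruxes/DensityResponse/Disproof.lean` (generation 2, re-deriving generation 1's
findings (d) and (h) importably); `sorry`-free, standard axioms.  The two `iff`s below mention the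
Theses decl `DensityResponse` only inside an equivalence with a variant (neither direction proves it).

* `densityResponseAllSigns_iff : DensityResponseAllSigns ↔ DensityResponse` — the sign condition
  `0 ≤ s` is decoration (`s < 0` makes the tilt term `ofReal` of a non-positive number).
* `densityResponseNoAbs_iff : DensityResponseNoAbs ↔ DensityResponse` — the absolute value around the
  source is decoration: a state with negative source is replaced by its half-wavelength translate
  (`exists_translate_source_neg`, `t = L n/(2|n|²)`, via the tree's `PeriodicTrialState.exists_translate`,
  `periodicEnergy_translate`, `setIntegral_cellN_comp_add`).
So provers may read the crux as: `∀ s : ℝ ∀ Φ, E₀ + ofReal(s·⟨V_k⟩_Φ) ≤ E(Φ) + ofReal(Cs²N/(k∞²+ρa))`.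
-/

noncomputable section

open MeasureTheory Set Filter Metric
open scoped ENNReal NNReal BigOperators Classical

namespace Summit.AtomisticToContinuum.BoseEinsteinCondensation.Theorems.DensityResponse.Negative

open Literature.MathematicalPhysics.QuantumManyBody.BoseGas

section Decorations

variable {N : ℕ} {L : ℝ}

/-- **`DensityResponse` with `∀ s : ℝ` in place of `∀ s ≥ 0`.**  A variant STATEMENT (untagged). -/
def DensityResponseAllSigns : Prop :=
  ∀ v : ℝ → ℝ≥0∞, IsRepulsiveFiniteRange v → ∀ M : ℝ, 0 < M → ∃ ρ₀ C : ℝ, 0 < ρ₀ ∧ 0 < C ∧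
    ∃ N₀ : ℕ, ∀ N : ℕ, N₀ ≤ N → ∀ L : ℝ, 0 < L → (N : ℝ) ≤ ρ₀ * L ^ 3 → ∀ n : Fin 3 → ℤ, n ≠ 0 →
    2 * Real.pi * ‖(fun j => (n j : ℝ))‖ / L ≤ M * Real.sqrt (N / L ^ 3) → ∀ s : ℝ,
    ∀ Φ : PeriodicTrialState N L,
      periodicGroundStateEnergy v N L + ENNReal.ofReal (s * |∫ X in cellN N L,
        (∑ i, 2 * Real.cos (2 * Real.pi / L * ∑ j, (n j : ℝ) * X i j)) * ‖Φ.ψ X‖ ^ 2|) ≤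
      periodicEnergy v Φ + ENNReal.ofReal (C * s ^ 2 * N /
        ((2 * Real.pi * ‖(fun j => (n j : ℝ))‖ / L) ^ 2 + N / L ^ 3 * (scatteringLength v).toReal))

/-- **`0 ≤ s` is decoration** (gen 1 (d)): for `s < 0` the tilt term is `ofReal` of a non-positive
number, i.e. `0`, and the chord is the variational principle. [folklore] -/
theorem densityResponseAllSigns_iff :
    DensityResponseAllSigns ↔
      Summit.AtomisticToContinuum.BoseEinsteinCondensation.Theses.BECThomsonPrinciple.DensityResponse := by
  constructor
  · intro h v hv M hM
    obtain ⟨ρ₀, C, hρ₀, hC, N₀, H⟩ := h v hv M hM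
    exact ⟨ρ₀, C, hρ₀, hC, N₀, fun N hN L hL hd n hn hw s _ Φ => H N hN L hL hd n hn hw s Φ⟩
  · intro h v hv M hM
    obtain ⟨ρ₀, C, hρ₀, hC, N₀, H⟩ := h v hv M hM
    refine ⟨ρ₀, C, hρ₀, hC, N₀, fun N hN L hL hd n hn hw s Φ => ?_⟩
    rcases le_or_gt 0 s with hs | hs
    · exact H N hN L hL hd n hn hw s hs Φ
    · rw [ENNReal.ofReal_of_nonpos (mul_nonpos_of_nonpos_of_nonneg hs.le (abs_nonneg _)), add_zero]
      exact (periodicGroundStateEnergy_le v Φ).trans le_self_add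

/-- **`DensityResponse` with the SIGNED source** (no absolute value).  A variant STATEMENT (untagged). -/
def DensityResponseNoAbs : Prop :=
  ∀ v : ℝ → ℝ≥0∞, IsRepulsiveFiniteRange v → ∀ M : ℝ, 0 < M → ∃ ρ₀ C : ℝ, 0 < ρ₀ ∧ 0 < C ∧
    ∃ N₀ : ℕ, ∀ N : ℕ, N₀ ≤ N → ∀ L : ℝ, 0 < L → (N : ℝ) ≤ ρ₀ * L ^ 3 → ∀ n : Fin 3 → ℤ, n ≠ 0 →
    2 * Real.pi * ‖(fun j => (n j : ℝ))‖ / L ≤ M * Real.sqrt (N / L ^ 3) → ∀ s : ℝ, 0 ≤ s →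
    ∀ Φ : PeriodicTrialState N L,
      periodicGroundStateEnergy v N L + ENNReal.ofReal (s * ∫ X in cellN N L,
        (∑ i, 2 * Real.cos (2 * Real.pi / L * ∑ j, (n j : ℝ) * X i j)) * ‖Φ.ψ X‖ ^ 2) ≤
      periodicEnergy v Φ + ENNReal.ofReal (C * s ^ 2 * N /
        ((2 * Real.pi * ‖(fun j => (n j : ℝ))‖ / L) ^ 2 + N / L ^ 3 * (scatteringLength v).toReal))

/-- **Half-wavelength translation flips the source**: for `n ≠ 0` and `t = L n/(2|n|²)`,
`⟨Σᵢ 2cos(k·xᵢ)⟩_{Φ(· − t)} = −⟨Σᵢ 2cos(k·xᵢ)⟩_Φ`, at equal energy. [folklore] -/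
theorem exists_translate_source_neg (hL : 0 < L) {n : Fin 3 → ℤ} (hn : n ≠ 0) (Φ : PeriodicTrialState N L) :
    ∃ Ψ : PeriodicTrialState N L, (∀ v, periodicEnergy v Ψ = periodicEnergy v Φ) ∧
      ∫ X in cellN N L, (∑ i, 2 * Real.cos (2 * Real.pi / L * ∑ j, (n j : ℝ) * X i j)) * ‖Ψ.ψ X‖ ^ 2 =
        - ∫ X in cellN N L, (∑ i, 2 * Real.cos (2 * Real.pi / L * ∑ j, (n j : ℝ) * X i j)) * ‖Φ.ψ X‖ ^ 2 := by
  -- the half-wavelength shift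
  set S : ℝ := ∑ j, (n j : ℝ) ^ 2 with hS_def
  have hS : 0 < S := by
    obtain ⟨l, hl⟩ : ∃ l, n l ≠ 0 := by
      by_contra hcon
      push Not at hcon
      exact hn (funext hcon)
    have : (0 : ℝ) < (n l : ℝ) ^ 2 := by
      have : (n l : ℝ) ≠ 0 := by exact_mod_cast hl
      positivity
    exact lt_of_lt_of_le this (Finset.single_le_sum (f := fun j => (n j : ℝ) ^ 2)
      (fun j _ => sq_nonneg _) (Finset.mem_univ l))
  set t : Space := WithLp.toLp 2 fun j => L * (n j : ℝ) / (2 * S) with ht_def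
  have hnt : ∑ j, (n j : ℝ) * t j = L / 2 := by
    simp only [ht_def, PiLp.toLp_apply]
    have : ∀ j, (n j : ℝ) * (L * (n j : ℝ) / (2 * S)) = (L / (2 * S)) * (n j : ℝ) ^ 2 := fun j => by ring
    simp_rw [this]
    rw [← Finset.mul_sum, ← hS_def]
    field_simp
  obtain ⟨Ψ, hΨ⟩ := Φ.exists_translate t
  refine ⟨Ψ, fun v => periodicEnergy_translate v Φ t hΨ, ?_⟩
  -- the shifted source
  set T : Config N := fun _ => t with hT_def
  have hphase : ∀ (X : Config N) (i : Fin N),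
      2 * Real.pi / L * ∑ j, (n j : ℝ) * (X + T) i j =
        2 * Real.pi / L * ∑ j, (n j : ℝ) * X i j + Real.pi := by
    intro X i
    have hTi : (X + T) i = X i + t := rfl
    simp only [hTi, PiLp.add_apply, mul_add, Finset.sum_add_distrib, hnt]
    field_simp
  set G : Config N → ℝ := fun X =>
    (∑ i, 2 * Real.cos (2 * Real.pi / L * ∑ j, (n j : ℝ) * X i j)) * ‖Ψ.ψ X‖ ^ 2 with hG_def
  have hGper : ∀ (X : Config N) (i : Fin N) (k : Fin 3),
      G (X + Pi.single i (EuclideanSpace.single k L)) = G X := by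
    intro X i k
    simp only [hG_def, Ψ.periodic X i k]
    congr 1
    refine Finset.sum_congr rfl fun i' _ => ?_
    congr 1
    have := phase_add_single hL.ne' n i' i k X
    unfold phase at this
    rw [this]
    split_ifs
    · rw [Real.cos_add_int_mul_two_pi]
    · rw [add_zero]
  have hshift := setIntegral_cellN_comp_add hL hGper T
  rw [← hshift]
  have hΨT : ∀ X : Config N, Ψ.ψ (X + T) = Φ.ψ X := by
    intro X; rw [hΨ]; simp [hT_def]
  simp only [hG_def, hΨT, hphase, Real.cos_add_pi, mul_neg, Finset.sum_neg_distrib, neg_mul, integral_neg]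

/-- **The absolute value is decoration** (gen 1 (h)): `DensityResponseNoAbs ↔ DensityResponse`
(a state with negative source is replaced by its half-wavelength translate). [folklore] -/
theorem densityResponseNoAbs_iff :
    DensityResponseNoAbs ↔
      Summit.AtomisticToContinuum.BoseEinsteinCondensation.Theses.BECThomsonPrinciple.DensityResponse := by
  constructor
  · intro h v hv M hM
    obtain ⟨ρ₀, C, hρ₀, hC, N₀, H⟩ := h v hv M hM
    refine ⟨ρ₀, C, hρ₀, hC, N₀, fun N hN L hL hd n hn hw s hs Φ => ?_⟩
    rcases le_or_gt 0 (∫ X in cellN N L,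
        (∑ i, 2 * Real.cos (2 * Real.pi / L * ∑ j, (n j : ℝ) * X i j)) * ‖Φ.ψ X‖ ^ 2) with hpos | hneg
    · rw [abs_of_nonneg hpos]; exact H N hN L hL hd n hn hw s hs Φ
    · obtain ⟨Ψ, hE, hsrc⟩ := exists_translate_source_neg hL hn Φ
      have := H N hN L hL hd n hn hw s hs Ψ
      rwa [hsrc, hE v, ← abs_of_neg hneg] at this
  · intro h v hv M hM
    obtain ⟨ρ₀, C, hρ₀, hC, N₀, H⟩ := h v hv M hM
    refine ⟨ρ₀, C, hρ₀, hC, N₀, fun N hN L hL hd n hn hw s hs Φ => ?_⟩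
    refine le_trans ?_ (H N hN L hL hd n hn hw s hs Φ)
    gcongr
    exact le_abs_self _

end Decorations

end Summit.AtomisticToContinuum.BoseEinsteinCondensation.Theorems.DensityResponse.Negative

end
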